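import Mathlib
import Literature.NumberTheory.Automorphic.HeckeLatticeCount

/-!
# Elementary symmetric functions: the merging bound behind the trace–Graeffe certificate (venture `DiscreteObjects`, target L)

Cell `pub-namedobj`, seat `pub-namedobj-mahler-g16`. Framing: lottery ticket; floor = certified bounds/negative ranges.

Pure real inequalities for `Multiset.esymm`, used by the cheaper rejection certificate of the degree-20 kernel census
(`CensusTraceCertificate`): with `g r = r + r⁻¹`,
* the cons formula `e_{k+1}(a :: s) = e_{k+1}(s) + a · e_k(s)` and `e_0 = 1` are REUSED from
  `Literature.NumberTheory.Automorphic.HeckeLatticeCount` (`multiset_esymm_cons_succ`, `multiset_esymm_zero_right`);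
  here: two-step expansion, nonnegativity and monotonicity in one entry;
* `norm_esymm_le_esymm_map` — `‖e_k(s)‖ ≤ e_k(s.map f)` whenever `‖y‖ ≤ f y` on `s`;
* `esymm_merge_heads` — for `u, v ≥ 1`: `e_k(g u :: g v :: T) ≤ e_k(g (u v) :: 2 :: T)` (`T ≥ 0` entrywise), from
  `g u + g v ≤ g(uv) + 2` and `g u · g v ≤ 2 g(uv)`;
* `esymm_map_joukRad_le` — MERGING: `e_k((a :: R).map g + S) ≤ e_k(g(a · ∏ R) :: (replicate |R| 2 + S))` for entries `≥ 1`;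
* `esymm_replicate`, `esymm_cons_replicate_two` — the closed form `e_k(c :: replicate t 2) = 2^k C(t,k) + c 2^(k-1) C(t,k-1)`.
Consequence (in `CensusTraceCertificate`): if `y_i = β_i^N + β_i^{-N}` over the root pairs of a reciprocal `P` with `M(P) ≤ B`
then `|e_k(y)| ≤ 2^k C(d-1,k) + (B^N + B^{-N}) 2^{k-1} C(d-1,k-1)`.
-/

namespace Summit.Ventures.DiscreteObjects.Mahler

open Multiset Literature.NumberTheory.Automorphic

/-! ## The cons formula and its consequences -/

/-- `e_{k+2}(x :: y :: T)` expanded. -/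
theorem esymm_cons_cons_add_two {R : Type*} [CommSemiring R] (x y : R) (T : Multiset R) (k : ℕ) :
    (x ::ₘ y ::ₘ T).esymm (k + 2) = T.esymm (k + 2) + (x + y) * T.esymm (k + 1) + x * y * T.esymm k := by
  rw [multiset_esymm_cons_succ, multiset_esymm_cons_succ, show k + 2 = (k + 1) + 1 from rfl, multiset_esymm_cons_succ]
  ring

/-- `e_1(x :: y :: T) = e_1(T) + x + y`. -/
theorem esymm_cons_cons_one {R : Type*} [CommSemiring R] (x y : R) (T : Multiset R) :
    (x ::ₘ y ::ₘ T).esymm 1 = T.esymm 1 + (x + y) := by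
  rw [show (1 : ℕ) = 0 + 1 from rfl, multiset_esymm_cons_succ, multiset_esymm_cons_succ, multiset_esymm_zero_right, multiset_esymm_zero_right]
  ring

/-- Elementary symmetric functions of nonnegative reals are nonnegative (local copy of a standard fact). -/
private theorem esymm_nonneg_of_forall_nonneg {s : Multiset ℝ} (hs : ∀ x ∈ s, 0 ≤ x) (k : ℕ) : 0 ≤ s.esymm k := by
  unfold Multiset.esymm
  refine Multiset.sum_nonneg fun b hb => ?_
  rw [Multiset.mem_map] at hb
  obtain ⟨t, ht, rfl⟩ := hb
  rw [Multiset.mem_powersetCard] at ht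
  exact Multiset.prod_nonneg fun a ha => hs a (Multiset.mem_of_le ht.1 ha)

/-- Monotonicity in one (new) entry: `a ≤ b` gives `e_k(a :: s) ≤ e_k(b :: s)` for nonnegative `s`. -/
theorem esymm_cons_le_cons {s : Multiset ℝ} (hs : ∀ x ∈ s, 0 ≤ x) {a b : ℝ} (hab : a ≤ b) (k : ℕ) :
    (a ::ₘ s).esymm k ≤ (b ::ₘ s).esymm k := by
  cases k with
  | zero => rw [multiset_esymm_zero_right, multiset_esymm_zero_right]
  | succ k =>
    rw [multiset_esymm_cons_succ, multiset_esymm_cons_succ]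
    have := esymm_nonneg_of_forall_nonneg hs k
    nlinarith

/-- Adding a nonnegative entry does not decrease `e_k`. -/
theorem esymm_le_esymm_cons {s : Multiset ℝ} (hs : ∀ x ∈ s, 0 ≤ x) {a : ℝ} (ha : 0 ≤ a) (k : ℕ) :
    s.esymm k ≤ (a ::ₘ s).esymm k := by
  cases k with
  | zero => rw [multiset_esymm_zero_right, multiset_esymm_zero_right]
  | succ k =>
    rw [multiset_esymm_cons_succ]
    have := esymm_nonneg_of_forall_nonneg hs k
    nlinarith

/-- `‖e_k(s)‖ ≤ e_k(s.map f)` if `‖y‖ ≤ f y` for `y ∈ s`. -/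
theorem norm_esymm_le_esymm_map (f : ℂ → ℝ) :
    ∀ (s : Multiset ℂ), (∀ y ∈ s, ‖y‖ ≤ f y) → ∀ k : ℕ, ‖s.esymm k‖ ≤ (s.map f).esymm k := by
  intro s
  induction s using Multiset.induction_on with
  | empty =>
    intro _ k
    cases k with
    | zero => simp [multiset_esymm_zero_right]
    | succ k => simp [Multiset.esymm]
  | cons a s ih =>
    intro hf k
    have hfs : ∀ y ∈ s, ‖y‖ ≤ f y := fun y hy => hf y (Multiset.mem_cons_of_mem hy)
    have hnn : ∀ x ∈ s.map f, 0 ≤ x := by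
      intro x hx
      rw [Multiset.mem_map] at hx
      obtain ⟨y, hy, rfl⟩ := hx
      exact (norm_nonneg y).trans (hfs y hy)
    cases k with
    | zero => simp [multiset_esymm_zero_right]
    | succ k =>
      rw [Multiset.map_cons, multiset_esymm_cons_succ, multiset_esymm_cons_succ]
      have h1 := ih hfs (k + 1)
      have h2 := ih hfs k
      have ha := hf a (Multiset.mem_cons_self a s)
      calc ‖s.esymm (k + 1) + a * s.esymm k‖ ≤ ‖s.esymm (k + 1)‖ + ‖a‖ * ‖s.esymm k‖ := by
            rw [← norm_mul]; exact norm_add_le _ _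
        _ ≤ (s.map f).esymm (k + 1) + f a * (s.map f).esymm k := by
            have := esymm_nonneg_of_forall_nonneg hnn k
            have : ‖a‖ * ‖s.esymm k‖ ≤ f a * (s.map f).esymm k :=
              mul_le_mul ha h2 (norm_nonneg _) ((norm_nonneg a).trans ha)
            linarith

/-! ## The merging step -/

/-- `g r = r + r⁻¹` (the bound `|β^N + β^{-N}| ≤ g(|β|^N)`). -/
noncomputable def joukRad (r : ℝ) : ℝ := r + r⁻¹

/-- `g 1 = 2`. -/
theorem joukRad_one : joukRad 1 = 2 := by norm_num [joukRad]

/-- `2 ≤ g r` for `r > 0`. -/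
theorem two_le_joukRad {r : ℝ} (hr : 0 < r) : 2 ≤ joukRad r := by
  unfold joukRad
  have h : 0 ≤ (r - 1) ^ 2 / r := by positivity
  have e : (r - 1) ^ 2 / r = r + r⁻¹ - 2 := by field_simp; ring
  linarith

/-- `g` is monotone on `[1, ∞)`. -/
theorem joukRad_mono {r s : ℝ} (hr : 1 ≤ r) (hrs : r ≤ s) : joukRad r ≤ joukRad s := by
  unfold joukRad
  have hr0 : 0 < r := by linarith
  have hs0 : 0 < s := by linarith
  have e : s + s⁻¹ - (r + r⁻¹) = (s - r) * (r * s - 1) / (r * s) := by field_simp; ring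
  have : 0 ≤ (s - r) * (r * s - 1) / (r * s) := by
    apply div_nonneg _ (by positivity)
    exact mul_nonneg (by linarith) (by nlinarith)
  linarith

/-- `g u + g v ≤ g(uv) + 2` for `u, v ≥ 1`. -/
theorem joukRad_add_le {u v : ℝ} (hu : 1 ≤ u) (hv : 1 ≤ v) : joukRad u + joukRad v ≤ joukRad (u * v) + 2 := by
  unfold joukRad
  have hu0 : 0 < u := by linarith
  have hv0 : 0 < v := by linarith
  have e : u * v + (u * v)⁻¹ + 2 - (u + u⁻¹ + (v + v⁻¹)) = (u - 1) * (v - 1) * (u * v + 1) / (u * v) := by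
    field_simp; ring
  have : 0 ≤ (u - 1) * (v - 1) * (u * v + 1) / (u * v) := by
    apply div_nonneg _ (by positivity)
    exact mul_nonneg (mul_nonneg (by linarith) (by linarith)) (by positivity)
  linarith

/-- `g u · g v ≤ 2 g(uv)` for `u, v ≥ 1`. -/
theorem joukRad_mul_le {u v : ℝ} (hu : 1 ≤ u) (hv : 1 ≤ v) : joukRad u * joukRad v ≤ 2 * joukRad (u * v) := by
  unfold joukRad
  have hu0 : 0 < u := by linarith
  have hv0 : 0 < v := by linarith
  have e : 2 * (u * v + (u * v)⁻¹) - (u + u⁻¹) * (v + v⁻¹) = (u ^ 2 - 1) * (v ^ 2 - 1) / (u * v) := by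
    field_simp; ring
  have : 0 ≤ (u ^ 2 - 1) * (v ^ 2 - 1) / (u * v) := by
    apply div_nonneg _ (by positivity)
    exact mul_nonneg (by nlinarith) (by nlinarith)
  linarith

/-- **Merging two heads.** For `u, v ≥ 1` and nonnegative `T`: `e_k(g u :: g v :: T) ≤ e_k(g(uv) :: 2 :: T)`. -/
theorem esymm_merge_heads {T : Multiset ℝ} (hT : ∀ x ∈ T, 0 ≤ x) {u v : ℝ} (hu : 1 ≤ u) (hv : 1 ≤ v) (k : ℕ) :
    (joukRad u ::ₘ joukRad v ::ₘ T).esymm k ≤ (joukRad (u * v) ::ₘ 2 ::ₘ T).esymm k := by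
  have h1 := joukRad_add_le hu hv
  have h2 := joukRad_mul_le hu hv
  rcases k with _ | _ | k
  · rw [multiset_esymm_zero_right, multiset_esymm_zero_right]
  · rw [esymm_cons_cons_one, esymm_cons_cons_one]; linarith
  · rw [esymm_cons_cons_add_two, esymm_cons_cons_add_two]
    have e1 := esymm_nonneg_of_forall_nonneg hT (k + 1)
    have e0 := esymm_nonneg_of_forall_nonneg hT k
    nlinarith [mul_le_mul_of_nonneg_right h1 e1, mul_le_mul_of_nonneg_right h2 e0]

/-- Entries `≥ 1` have product `≥ 1`. -/
theorem one_le_prod_of_forall_one_le {R : Multiset ℝ} (hR : ∀ r ∈ R, 1 ≤ r) : 1 ≤ R.prod := by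
  induction R using Multiset.induction_on with
  | empty => simp
  | cons a R ih =>
    rw [Multiset.prod_cons]
    have ha := hR a (Multiset.mem_cons_self a R)
    have := ih fun r hr => hR r (Multiset.mem_cons_of_mem hr)
    nlinarith

/-- **The merging bound.** For `a ≥ 1`, entries of `R` at least `1` and nonnegative `S`:
`e_k((a :: R).map g + S) ≤ e_k(g(a · ∏ R) :: (replicate |R| 2 + S))`. -/
theorem esymm_map_joukRad_le :
    ∀ (R : Multiset ℝ), (∀ r ∈ R, 1 ≤ r) → ∀ {a : ℝ}, 1 ≤ a → ∀ {S : Multiset ℝ}, (∀ x ∈ S, 0 ≤ x) → ∀ k : ℕ,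
      ((a ::ₘ R).map joukRad + S).esymm k ≤
        (joukRad (a * R.prod) ::ₘ (Multiset.replicate (Multiset.card R) 2 + S)).esymm k := by
  intro R
  induction R using Multiset.induction_on with
  | empty =>
    intro _ a _ S _ k
    simp
  | cons b R ih =>
    intro hR a ha S hS k
    have hb : 1 ≤ b := hR b (Multiset.mem_cons_self b R)
    have hR' : ∀ r ∈ R, 1 ≤ r := fun r hr => hR r (Multiset.mem_cons_of_mem hr)
    have hS2 : ∀ x ∈ (2 : ℝ) ::ₘ S, 0 ≤ x := by
      intro x hx
      rcases Multiset.mem_cons.mp hx with rfl | hx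
      · norm_num
      · exact hS x hx
    have hrest : ∀ x ∈ R.map joukRad + S, 0 ≤ x := by
      intro x hx
      rcases Multiset.mem_add.mp hx with hx | hx
      · rw [Multiset.mem_map] at hx
        obtain ⟨r, hr, rfl⟩ := hx
        have := two_le_joukRad (show (0 : ℝ) < r by linarith [hR' r hr])
        linarith
      · exact hS x hx
    -- merge the two heads `g a`, `g b`
    have step1 : ((a ::ₘ b ::ₘ R).map joukRad + S).esymm k ≤
        (joukRad (a * b) ::ₘ (2 : ℝ) ::ₘ (R.map joukRad + S)).esymm k := by
      rw [Multiset.map_cons, Multiset.map_cons, Multiset.cons_add, Multiset.cons_add]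
      exact esymm_merge_heads hrest ha hb k
    -- apply the induction hypothesis with head `a * b` and `2 ::ₘ S`
    have step2 := ih hR' (a := a * b) (by nlinarith) (S := (2 : ℝ) ::ₘ S) hS2 k
    have e1 : ((a * b) ::ₘ R).map joukRad + (2 : ℝ) ::ₘ S = joukRad (a * b) ::ₘ (2 : ℝ) ::ₘ (R.map joukRad + S) := by
      rw [Multiset.map_cons, Multiset.cons_add, Multiset.add_cons]
    have e2 : Multiset.replicate (Multiset.card R) (2 : ℝ) + (2 : ℝ) ::ₘ S =
        Multiset.replicate (Multiset.card (b ::ₘ R)) 2 + S := by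
      rw [Multiset.card_cons, Multiset.replicate_succ, Multiset.add_cons, Multiset.cons_add]
    rw [e1, e2] at step2
    rw [Multiset.prod_cons, ← mul_assoc]
    exact step1.trans step2

/-! ## Closed form -/

/-- `e_j(replicate t a) = a^j · C(t, j)`. -/
theorem esymm_replicate (a : ℝ) : ∀ (t j : ℕ), (Multiset.replicate t a).esymm j = a ^ j * (t.choose j : ℝ) := by
  intro t
  induction t with
  | zero =>
    intro j
    cases j with
    | zero => simp [multiset_esymm_zero_right]
    | succ j => simp [Multiset.esymm]
  | succ t ih =>
    intro j
    cases j with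
    | zero => simp [multiset_esymm_zero_right]
    | succ j =>
      rw [Multiset.replicate_succ, multiset_esymm_cons_succ, ih, ih, Nat.choose_succ_succ, Nat.cast_add]
      ring

/-- `e_{k+1}(c :: replicate t 2) = 2^{k+1} C(t,k+1) + c · 2^k C(t,k)`. -/
theorem esymm_cons_replicate_two (c : ℝ) (t k : ℕ) :
    (c ::ₘ Multiset.replicate t 2).esymm (k + 1) = 2 ^ (k + 1) * (t.choose (k + 1) : ℝ) + c * (2 ^ k * (t.choose k : ℝ)) := by
  rw [multiset_esymm_cons_succ, esymm_replicate, esymm_replicate]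

/-- **The bound in final form.** For `a ≥ 1`, entries of `R` at least `1`, `a · ∏ R ≤ B'` (`1 ≤ B'`):
`e_{k+1}((a :: R).map g) ≤ 2^{k+1} C(|R|, k+1) + g(B') 2^k C(|R|, k)`. -/
theorem esymm_map_joukRad_le_closed {R : Multiset ℝ} (hR : ∀ r ∈ R, 1 ≤ r) {a B' : ℝ} (ha : 1 ≤ a)
    (hB : a * R.prod ≤ B') (k : ℕ) :
    ((a ::ₘ R).map joukRad).esymm (k + 1) ≤
      2 ^ (k + 1) * ((Multiset.card R).choose (k + 1) : ℝ) + joukRad B' * (2 ^ k * ((Multiset.card R).choose k : ℝ)) := by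
  have h := esymm_map_joukRad_le R hR ha (S := 0) (by simp) (k + 1)
  rw [Multiset.add_zero, Multiset.add_zero] at h
  have h1 : 1 ≤ a * R.prod := by nlinarith [one_le_prod_of_forall_one_le hR]
  have hmono : (joukRad (a * R.prod) ::ₘ Multiset.replicate (Multiset.card R) 2).esymm (k + 1) ≤
      (joukRad B' ::ₘ Multiset.replicate (Multiset.card R) 2).esymm (k + 1) :=
    esymm_cons_le_cons (fun x hx => by rw [Multiset.eq_of_mem_replicate hx]; norm_num) (joukRad_mono h1 hB) _
  rw [esymm_cons_replicate_two (joukRad B')] at hmono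
  exact h.trans hmono

end Summit.Ventures.DiscreteObjects.Mahler
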